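import Literature.MathematicalPhysics.QuantumFieldTheory.Balaban1983to89.Node00.OpsYSectDE

/-!
# `Balaban1983to89.B8Eq158AtLettersY` — T. Bałaban, *Spaces of regular gauge field configurations on a lattice and gauge fixing conditions*,
# Commun. Math. Phys. **99** (1985) 75–102 [Balaban1985RegularSpaces], (1.57)–(1.58) p. 86 AT A GENERAL BACKGROUND `U`, AT THE CELL's
# COVARIANT LETTERS OF RECORD (def-Y's `Node00.OpsYDeltaA`: `Δ_a(U) = Δ(U) + D_U R(U) D*_U + Q*(U)aQ(U)`, `G(U) = Δ_a(U)⁻¹`):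
# the representation «A = G(U₀)J + G(U₀)Σ_j Q_j*Λ_j(Lʲη)⁻³B₁» of a Landau-gauge field, the algebraic half of Proposition 3

statement-level skeleton of published theorems with citation tags; proofs where landed; nothing here is a claim about the Yang–Mills mass gap

PDF held: `paper:balaban1985-cmp99-regular-spaces-gauge-fixing` (journal page = PDF page + 74); p. 86 [PDF 12] read AS AN IMAGE this session (render
`run/shared/lean/pub/pub-balaban/b2b-balaban-ref1/pages/1985-cmp99-regular-spaces-gauge-fixing/1985-cmp99-regular-spaces-gauge-fixing-p012-x2.png`);
[4] = T. Bałaban, *Propagators for lattice gauge theories in a background field*, Commun. Math. Phys. **99** (1985) 389–434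
[Balaban1985BackgroundPropagators], (3.10) p. 392, (3.25)–(3.27) pp. 394–395, Thm 3.3 p. 399 — through the tree module `Node00.OpsYDeltaA` (its verbatim
quotations of (3.25)–(3.27)) and `Node00.OpsYSectDE` (`hessY_one_eq_comp`).

CITATION HEADER (lean-in-tree rule).  Cell `lit-balaban`, seat `lit-balaban-r05` (gen 86; [B8] block owner), sub-row G-B8-T2S ∕ the displayed (B)-lines
`B8Thm2TorusKnitEstimatesOfMajorants.B9P3PerAt` of the M5.9 endpoint `B8Thm2TorusKnitCubeCore.hThm2_of_core` (R3 `stmt-QuantumFields-19200`, helper);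
design memo `lit-balaban-r05/BLINE-DESIGN-r05.md` §3, file B-LINE 1.  REUSED BY NAME: def-Y's letters `hessY ∕ gradY ∕ divY ∕ curlY ∕ coCurlY ∕ jordanY ∕
curv2Y ∕ QY ∕ QsY ∕ aY ∕ RY ∕ deltaAY ∕ GAY` and `GAY_mul_deltaAY ∕ deltaAY_mul_GAY` (`Node00.OpsYDeltaA`), `hessY_one_eq_comp` (`Node00.OpsYSectDE`).

WHAT IS PRINTED (verbatim, p. 86 [PDF 12]).  *"We make the translation A = A₁ + H(U₀)B₁, where the operator H(U₀) was defined in [4], and we get the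
equations D^{η*}_{U₀}D^η_{U₀}A₁ = J − D^{η*}_{U₀}D^η_{U₀}H(U₀)B₁, Q_jA₁ = 0 on Λ_j, R(U₀)D^{η*}_{U₀}A₁ = 0. (1.57)  They imply finally
A = G(U₀)J − G(U₀)D^{η*}_{U₀}D_{U₀}H(U₀)B₁ + H(U₀)B₁ = G(U₀)J + G(U₀)Σ_jQ*_jΛ_j(Lʲη)⁻³B₁, (1.58) where the operator G(U₀) was introduced and
investigated in [4]. Let us recall only the definition: G(U₀) = (D^{η*}_{U₀}D^η_{U₀} + D^η_{U₀}R(U₀)D^{η*}_{U₀} + Σ_jQ*_jΛ_j(Lʲη)⁻²Q_j)⁻¹.  Theorem 3.3 of [4]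
implies the bounds: |A|₍₋₁₎, |∇^η_{U₀}A|₍₋₂₎, |D^{η*}_{U₀}D^η_{U₀}A|₍₋₃₎, |Δ^η_{U₀}A|₍₋₃₎ ≦ B₀(|J|₍₋₃₎ + |B₁|) (1.59)"*; (1.55) p. 86: *"D^{η*}_{U₀}D^η_{U₀}A = J"*;
(1.38) p. 82 (the Landau gauge condition): *"R(U₀)D^{η*}_{U₀}A = 0"*.  [4] (3.26) p. 395: *"Δ_a(U) = Δ(U) + D_U R(U) D*_U + Q*(U)aQ(U), or simply Δ_a = Δ +
DRD* + Q*aQ. It coincides with Δ_a in (2.19) if U = 1."*; (3.27): *"we denote its inverse again by G, or G(U)"*; (3.10) p. 392: *"⟨A, ΔA⟩ = ⟨A, D*DA⟩ +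
⟨A, Δ′A⟩"* (the Hessian of the Wilson action: `D*D` plus the curvature insertion `Δ′`).

THE MATHEMATICS (kernel-checked).  At def-Y's letters the printed definition (3.26) is LITERAL: `deltaAY i parS parB Gp U = hessY i U + gradY i U ∘ RY i parS
Gp U ∘ divY i U + QsY i parB U ∘ aY i ∘ QY i parB U`, `GAY … U = Ring.inverse (deltaAY … U)`.  Hence, for a field `A` IN THE LANDAU GAUGE OF `U` — print's
(1.38) `R(U)D*_U A = 0`, typed `RY i parS Gp U (divY i U A) = 0` — the middle summand drops out: `Δ_a(U)A = Δ(U)A + Q*aQA` (§1), and wherever `Δ_a(U)` is a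
unit ([4] Thm 3.3's regime; the cell's M5.3 ∕ `hinvU` datum) **`A = G(U)(Δ(U)A + Q*(U)aQ(U)A)`** (§2, ★ `eq158_atLettersY`) — (1.58) with `J := Δ(U)A` and the
averaging term `Q*aQA` (= print's `Σ_jQ_j*Λ_j(Lʲη)⁻³B₁`, `B₁ = LʲηQ_jA`, the weights `a_j(Lʲη)⁻²` carried by def-Y's `aY`); print's auxiliary operator `H(U₀)` of
(1.57) is NOT needed for (1.58) (it re-enters only through the NORM of the second term in Prop. 3).  §3 splits def-Y's Hessian (3.10) as `Δ(U)A = D*_U D_U A +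
Δ′(U)A` with the curvature insertion `Δ′(U)A = D*_U((𝒦_U − 1)D_U A) + Δ′₂(U)A` written out, and proves `Δ′(1) = 0` (`hessY_one_eq_comp`): p. 86 DISPLAYS
`G(U₀)` with `D^{η*}_{U₀}D^η_{U₀}` where [4]'s `G` inverts `Δ_a` built on the Hessian `Δ(U₀)` — the two agree at `U₀ = 1` and differ by the curvature term,
which is `O(α₀)`-small on `𝔄_k(α₀)` and is removed by print's own bootstrap between (1.59) and (1.60) (the NEXT file, B-LINE 2; no estimate here).  §4 is the
three-term form `A = G(U)(D*_U D_U A) + G(U)(Δ′(U)A) + G(U)(Q*aQA)`; §5 the uniqueness half of (1.57): a Landau-gauge field is determined by `D*_U D_U A + Δ′(U)A`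
and its averages `Q(U)A`.

HONEST SCOPE.  Algebra only: every identity is an instance of `G(U)·Δ_a(U) = 1` and of the literal definition (3.26); NO inequality of [B8] ∕ [4] is proved
or assumed; invertibility of `Δ_a(U)` is a displayed hypothesis `IsUnit (deltaAY …)` (Thm 3.3's content at general `U`, M5.3 ∕ M5.7 of sub-row G-B9-LETTERS);
the Landau condition is displayed in def-Y's projection form `RY … (divY … A) = 0` — its identification with the knit's multiplier form `B8Eq138LandauZd.IsLandau138`
is the bond junction (memo B-LINE 3), not made here; general C⋆-free coefficient algebra `𝔸` (normed ℂ-algebra, complete), general transporters `parS ∕ parB`,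
general site letter `Gp`.  Count-neutral; `B9P3PerAt` ∕ N05 ∕ `stub_PV3A` NOT discharged; nothing continuum ∕ ℝ⁴ ∕ OS ∕ mass-gap ∕ Clay — the Yang–Mills mass gap
is NOT proved by any of this (Track A conditional rung).  No `sorry`, no `def`, no `… : Prop` fact, no `instance`, no `notation`.  NEW file; nothing landed is
modified.  Seat `lit-balaban-r05` gen 86, 2026-08-28.
-/

noncomputable section

namespace Literature.MathematicalPhysics.QuantumFieldTheory.Balaban1983to89.B8Eq158AtLettersY

open Node00
open B6KLevelCensusIndexV1 (KIdx)

variable {d ℓ : ℕ} {hd : 1 ≤ d + 1} {hL : Odd (ℓ + 1) ∧ 1 < ℓ + 1} {b₀ b₁ : ℝ}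
variable {𝔸 : Type} [NormedRing 𝔸] [NormedAlgebra ℂ 𝔸] [CompleteSpace 𝔸]
variable (i : KIdx d ℓ hd hL b₀ b₁)

/-! ## §1 The Landau gauge kills the middle summand of `Δ_a(U)` -/

section Landau

variable (parS : SiteParY 𝔸 i) (parB : BondParY 𝔸 i) (Gp : SiteOpY 𝔸 i) (U : CfgY 𝔸 i)

/-- **(3.26) APPLIED**: `Δ_a(U)A = Δ(U)A + D_U(R(U)D*_U A) + Q*(U)aQ(U)A` — def-Y's definition, read on a field.
[cite: Balaban1985BackgroundPropagators, (3.26) p.395; Balaban1985RegularSpaces, p.86 (definition of G(U₀))] -/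
theorem deltaAY_apply (A : FBondY i → 𝔸) :
    deltaAY i parS parB Gp U A =
      hessY i U A + gradY i U (RY i parS Gp U (divY i U A)) + QsY i parB U (aY i (QY i parB U A)) := rfl

/-- **(1.57)₃ ⟹ the `D R D*` term drops out**: for a field `A` in the Landau gauge of `U` (`R(U)D*_U A = 0`, (1.38)),
`Δ_a(U)A = Δ(U)A + Q*(U)aQ(U)A`. [cite: Balaban1985RegularSpaces, (1.57)–(1.58) p.86, (1.38) p.82; Balaban1985BackgroundPropagators, (3.26) p.395] -/
theorem deltaAY_apply_of_landau {A : FBondY i → 𝔸} (hLan : RY i parS Gp U (divY i U A) = 0) :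
    deltaAY i parS parB Gp U A = hessY i U A + QsY i parB U (aY i (QY i parB U A)) := by
  rw [deltaAY_apply, hLan, map_zero, add_zero]

/-- The Landau condition is LINEAR in the field: differences of Landau-gauge fields are in the Landau gauge.
[cite: Balaban1985RegularSpaces, (1.38) p.82, (1.57) p.86, bookkeeping] -/
theorem landau_sub {A A' : FBondY i → 𝔸} (hA : RY i parS Gp U (divY i U A) = 0) (hA' : RY i parS Gp U (divY i U A') = 0) :
    RY i parS Gp U (divY i U (A - A')) = 0 := by
  rw [map_sub, map_sub, hA, hA', sub_zero]

end Landau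

/-! ## §2 ★ (1.58): `A = G(U)(Δ(U)A + Q*(U)aQ(U)A)` for a Landau-gauge field, wherever `Δ_a(U)` is a unit -/

section Eq158

variable (parS : SiteParY 𝔸 i) (parB : BondParY 𝔸 i) (Gp : SiteOpY 𝔸 i) (U : CfgY 𝔸 i)

/-- `G(U)(Δ_a(U)A) = A` wherever `Δ_a(U)` is invertible (`G(U)·Δ_a(U) = 1`, read on a field).
[cite: Balaban1985BackgroundPropagators, (3.27) p.395] -/
theorem GAY_deltaAY_apply (hU : IsUnit (deltaAY i parS parB Gp U)) (A : FBondY i → 𝔸) :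
    GAY i parS parB Gp U (deltaAY i parS parB Gp U A) = A := by
  have h := congrArg (fun T : Module.End ℂ (FBondY i → 𝔸) => T A) (GAY_mul_deltaAY i hU)
  simpa using h

/-- `Δ_a(U)(G(U)F) = F` wherever `Δ_a(U)` is invertible (`Δ_a(U)·G(U) = 1`, read on a field).
[cite: Balaban1985BackgroundPropagators, (3.27) p.395] -/
theorem deltaAY_GAY_apply (hU : IsUnit (deltaAY i parS parB Gp U)) (F : FBondY i → 𝔸) :
    deltaAY i parS parB Gp U (GAY i parS parB Gp U F) = F := by
  have h := congrArg (fun T : Module.End ℂ (FBondY i → 𝔸) => T F) (deltaAY_mul_GAY i hU)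
  simpa using h

/-- ★ **(1.58) AT THE LETTERS OF RECORD**: for `A` in the Landau gauge of `U` and `Δ_a(U)` a unit,
`A = G(U)(Δ(U)A + Q*(U)aQ(U)A)` — print's «A = G(U₀)J + G(U₀)Σ_jQ*_jΛ_j(Lʲη)⁻³B₁» with `J` the Hessian image `Δ(U)A` (see §3 for `D*D` versus `Δ(U)`)
and the averaging weights `a_j(Lʲη)⁻²` inside `aY`; the operator `H(U₀)` of the printed intermediate step is not needed.
[cite: Balaban1985RegularSpaces, (1.57)–(1.58) p.86; Balaban1985BackgroundPropagators, (3.26)–(3.27) p.395] -/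
theorem eq158_atLettersY (hU : IsUnit (deltaAY i parS parB Gp U)) {A : FBondY i → 𝔸} (hLan : RY i parS Gp U (divY i U A) = 0) :
    A = GAY i parS parB Gp U (hessY i U A + QsY i parB U (aY i (QY i parB U A))) := by
  rw [← deltaAY_apply_of_landau i parS parB Gp U hLan, GAY_deltaAY_apply i parS parB Gp U hU]

/-- (1.58), the two `G(U)`-terms separated: `A = G(U)(Δ(U)A) + G(U)(Q*(U)aQ(U)A)`.
[cite: Balaban1985RegularSpaces, (1.58) p.86] -/
theorem eq158_atLettersY_add (hU : IsUnit (deltaAY i parS parB Gp U)) {A : FBondY i → 𝔸} (hLan : RY i parS Gp U (divY i U A) = 0) :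
    A = GAY i parS parB Gp U (hessY i U A) + GAY i parS parB Gp U (QsY i parB U (aY i (QY i parB U A))) := by
  rw [← map_add]
  exact eq158_atLettersY i parS parB Gp U hU hLan

/-- The fixed-point reading of (1.58) used by the bootstrap (1.59)→(1.60): `A − G(U)(Q*(U)aQ(U)A) = G(U)(Δ(U)A)`.
[cite: Balaban1985RegularSpaces, (1.58)–(1.60) p.86] -/
theorem sub_GAY_QsaQ_eq (hU : IsUnit (deltaAY i parS parB Gp U)) {A : FBondY i → 𝔸} (hLan : RY i parS Gp U (divY i U A) = 0) :
    A - GAY i parS parB Gp U (QsY i parB U (aY i (QY i parB U A))) = GAY i parS parB Gp U (hessY i U A) := by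
  rw [sub_eq_iff_eq_add]
  exact eq158_atLettersY_add i parS parB Gp U hU hLan

end Eq158

/-! ## §3 The Hessian `Δ(U) = D*_U D_U + Δ′(U)`: p. 86 displays `D*D`, [4]'s `G` inverts the Hessian — the curvature insertion written out -/

section Curvature

variable (U : CfgY 𝔸 i)

/-- **def-Y's HESSIAN (3.10), SPLIT AS «D*D + CURVATURE»**: `Δ(U)A = D*_U(D_U A) + (D*_U((𝒦_U − 1)(D_U A)) + Δ′₂(U)A)`, where `𝒦_U` is the Jordan insertion of
`Re U(∂p)` and `Δ′₂(U)` the `Im U(∂p)`-commutator term; the bracket is print's `Δ′` of (3.10). [cite: Balaban1985BackgroundPropagators, (3.10) p.392; Balaban1985RegularSpaces, (1.55), (1.58) p.86] -/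
theorem hessY_apply_eq_dStarD_add_curv (A : FBondY i → 𝔸) :
    hessY i U A = coCurlY i U (curlY i U A) +
      (coCurlY i U (jordanY i U (curlY i U A) - curlY i U A) + curv2Y i U A) := by
  have h : hessY i U A = coCurlY i U (jordanY i U (curlY i U A)) + curv2Y i U A := rfl
  rw [h, map_sub]
  abel

/-- The curvature insertion, isolated: `Δ(U)A − D*_U(D_U A) = D*_U((𝒦_U − 1)(D_U A)) + Δ′₂(U)A`.
[cite: Balaban1985BackgroundPropagators, (3.10) p.392] -/
theorem hessY_sub_dStarD_apply (A : FBondY i → 𝔸) :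
    hessY i U A - coCurlY i U (curlY i U A) = coCurlY i U (jordanY i U (curlY i U A) - curlY i U A) + curv2Y i U A := by
  rw [hessY_apply_eq_dStarD_add_curv i U A, add_sub_cancel_left]

/-- **AT `U = 1` THE CURVATURE INSERTION VANISHES**: `Δ(1)A = D*_1(D_1 A)` (def-Y's `hessY_one_eq_comp`), i.e. p. 86's displayed `D^{η*}D^η` IS [4]'s Hessian at
the flat background — «It coincides with Δ_a in (2.19) if U = 1» ((3.26)). [cite: Balaban1985BackgroundPropagators, (3.26) p.395, (3.10) p.392; Balaban1985RegularSpaces, (1.58) p.86] -/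
theorem curv_apply_one (A : FBondY i → 𝔸) :
    coCurlY i (fun _ _ => 1) (jordanY i (fun _ _ => 1) (curlY i (fun _ _ => 1) A) - curlY i (fun _ _ => 1) A) +
        curv2Y i (fun _ _ => 1) A = 0 := by
  rw [← hessY_sub_dStarD_apply i (fun _ _ => 1) A, hessY_one_eq_comp i, LinearMap.comp_apply, sub_self]

/-- The same, as the statement `Δ(1)A = D*_1(D_1 A)` on fields. [cite: Balaban1985BackgroundPropagators, (3.10) p.392, (3.26) p.395] -/
theorem hessY_one_apply (A : FBondY i → 𝔸) :
    hessY i (fun _ _ => 1) A = coCurlY i (fun _ _ => 1) (curlY i (fun _ _ => 1) A) := by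
  rw [hessY_one_eq_comp i, LinearMap.comp_apply]

end Curvature

/-! ## §4 (1.58) in three terms: `A = G(U)J + G(U)(Δ′(U)A) + G(U)(Q*aQA)` with `J = D*_U D_U A` ((1.55)) -/

section ThreeTerms

variable (parS : SiteParY 𝔸 i) (parB : BondParY 𝔸 i) (Gp : SiteOpY 𝔸 i) (U : CfgY 𝔸 i)

/-- ★ **(1.58) WITH PRINT's `J = D^{η*}_{U₀}D^η_{U₀}A` ((1.55)) AND THE LOCATED CURVATURE TERM**: for `A` in the Landau gauge of `U` and `Δ_a(U)` a unit,
`A = G(U)(D*_U D_U A) + G(U)(D*_U((𝒦_U − 1)D_U A) + Δ′₂(U)A) + G(U)(Q*(U)aQ(U)A)`.  The middle term is absent from the printed display of `G(U₀)` (p. 86 writes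
`D*D` where [4]'s `G` inverts the Hessian); it vanishes at `U = 1` (`curv_apply_one`) and is the `O(α₀)` curvature insertion on `𝔄_k(α₀)` that the bootstrap
(1.59)→(1.60) absorbs (B-LINE 2). [cite: Balaban1985RegularSpaces, (1.55), (1.58)–(1.60) p.86; Balaban1985BackgroundPropagators, (3.10) p.392, (3.26)–(3.27) p.395] -/
theorem eq158_atLettersY_three (hU : IsUnit (deltaAY i parS parB Gp U)) {A : FBondY i → 𝔸} (hLan : RY i parS Gp U (divY i U A) = 0) :
    A = GAY i parS parB Gp U (coCurlY i U (curlY i U A)) +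
      GAY i parS parB Gp U (coCurlY i U (jordanY i U (curlY i U A) - curlY i U A) + curv2Y i U A) +
      GAY i parS parB Gp U (QsY i parB U (aY i (QY i parB U A))) := by
  rw [← map_add, ← hessY_apply_eq_dStarD_add_curv i U A]
  exact eq158_atLettersY_add i parS parB Gp U hU hLan

/-- (1.58) AT THE FLAT BACKGROUND `U = 1`, in print's displayed letters exactly: `A = G(1)(D*_1 D_1 A) + G(1)(Q*(1)aQ(1)A)` (no curvature term) — the algebraic
identity behind r05's hypothesis-free `B8Eq158FlatTorus` ∕ `B8Ineq159FlatTorus`, now at def-Y's letters. [cite: Balaban1985RegularSpaces, (1.58) p.86; Balaban1985BackgroundPropagators, (3.26) p.395 («if U = 1»)] -/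
theorem eq158_atLettersY_one {parS : SiteParY 𝔸 i} {parB : BondParY 𝔸 i} {Gp : SiteOpY 𝔸 i}
    (hU : IsUnit (deltaAY i parS parB Gp (fun _ _ => 1))) {A : FBondY i → 𝔸}
    (hLan : RY i parS Gp (fun _ _ => 1) (divY i (fun _ _ => 1) A) = 0) :
    A = GAY i parS parB Gp (fun _ _ => 1) (coCurlY i (fun _ _ => 1) (curlY i (fun _ _ => 1) A)) +
      GAY i parS parB Gp (fun _ _ => 1) (QsY i parB (fun _ _ => 1) (aY i (QY i parB (fun _ _ => 1) A))) := by
  rw [← hessY_one_apply i A]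
  exact eq158_atLettersY_add i parS parB Gp (fun _ _ => 1) hU hLan

end ThreeTerms

/-! ## §5 The uniqueness half of (1.57): a Landau-gauge field is determined by `Δ(U)A` and its averages `Q(U)A` -/

section Uniqueness

variable (parS : SiteParY 𝔸 i) (parB : BondParY 𝔸 i) (Gp : SiteOpY 𝔸 i) (U : CfgY 𝔸 i)

/-- **A LANDAU-GAUGE FIELD WITH `Δ(U)A = 0` AND `Q(U)A = 0` VANISHES** (wherever `Δ_a(U)` is a unit): the homogeneous case of (1.57) — `D*DA₁ = 0`, `Q_jA₁ = 0`,
`R(U₀)D*A₁ = 0` force `A₁ = 0`. [cite: Balaban1985RegularSpaces, (1.57) p.86; Balaban1985BackgroundPropagators, (3.26)–(3.27) p.395] -/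
theorem eq_zero_of_landau (hU : IsUnit (deltaAY i parS parB Gp U)) {A : FBondY i → 𝔸} (hLan : RY i parS Gp U (divY i U A) = 0)
    (hH : hessY i U A = 0) (hQ : QY i parB U A = 0) : A = 0 := by
  rw [eq158_atLettersY i parS parB Gp U hU hLan, hH, hQ, map_zero, map_zero, zero_add, map_zero]

/-- **UNIQUENESS**: two Landau-gauge fields with the same Hessian image `Δ(U)A = Δ(U)A′` and the same averages `Q(U)A = Q(U)A′` coincide (wherever `Δ_a(U)` is a
unit) — so the representation (1.58) characterises `A`. [cite: Balaban1985RegularSpaces, (1.57)–(1.58) p.86] -/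
theorem eq_of_landau_of_hessY_eq_of_QY_eq (hU : IsUnit (deltaAY i parS parB Gp U)) {A A' : FBondY i → 𝔸}
    (hA : RY i parS Gp U (divY i U A) = 0) (hA' : RY i parS Gp U (divY i U A') = 0)
    (hH : hessY i U A = hessY i U A') (hQ : QY i parB U A = QY i parB U A') : A = A' := by
  have h0 : A - A' = 0 :=
    eq_zero_of_landau i parS parB Gp U hU (landau_sub i parS Gp U hA hA')
      (by rw [map_sub, hH, sub_self]) (by rw [map_sub, hQ, sub_self])
  exact sub_eq_zero.mp h0

/-- **THE INHOMOGENEOUS FORM**: if `F` solves `Δ_a(U)X = Δ(U)A + Q*(U)aQ(U)A` then `X = A` for the Landau-gauge field `A` — i.e. `A` is THE solution of the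
`Δ_a`-equation with print's right-hand side. [cite: Balaban1985RegularSpaces, (1.57)–(1.58) p.86; Balaban1985BackgroundPropagators, (3.27) p.395] -/
theorem eq_of_deltaAY_eq (hU : IsUnit (deltaAY i parS parB Gp U)) {A X : FBondY i → 𝔸} (hLan : RY i parS Gp U (divY i U A) = 0)
    (hX : deltaAY i parS parB Gp U X = hessY i U A + QsY i parB U (aY i (QY i parB U A))) : X = A := by
  have h := congrArg (GAY i parS parB Gp U) hX
  rw [GAY_deltaAY_apply i parS parB Gp U hU] at h
  rw [h]
  exact (eq158_atLettersY i parS parB Gp U hU hLan).symm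

end Uniqueness

end Literature.MathematicalPhysics.QuantumFieldTheory.Balaban1983to89.B8Eq158AtLettersY

end
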